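import Literature.Probability.RandomPlanarGeometry.SAWZdLateralClassCensus
import HarnessLib

/-!
# The two-point count along the force axis on `ℤ^{d+1}` — `#{ω ∈ SAW_n : ω(n) = h·e₀}` — is an INTEGER POLYNOMIAL IN `2d` (hyperoctahedral normal form,
# dimension congruence): an instance of the generic lateral axis-class census

Topic `Literature/Probability/RandomPlanarGeometry` (continues `SAWZdLateralClassCensus.lean`: `exists_int_polynomial_card_filter_saws`, `card_filter_saws_eq_sum_classes_mul_descFactorial`,
`dvd_sub_card_filter_saws`, the signed relabelling `latRelabel` of `SAWPulledLargeForceExpansionZdHyperoctahedral`).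

PRINTED CONTEXT (locators only). Madras–Slade (1993) §1.1 eq. (1.1.8) p. 5 (the `1/d` device), §1.3 (the two-point function `c_n(0,x)`); Graham (2010) §4. NOT IN PRINT
(lane statement): the class «`n`-step self-avoiding walks of `ℤ^{d+1}` ending at the point `h·e₀` of the force axis» is transported by the lateral zero-extensions and invariant
under the signed relabellings of the lateral axes (both conditions concern the force coordinate and the vanishing of the lateral part of the endpoint), hence:

* ★★★ `exists_int_polynomial_card_saws_end_axis` — **`#{ω ∈ SAW_n(ℤ^{d+1}) : ω(n) = h·e₀} = Q_{n,h}(2d)` for every `d`, `Q_{n,h} ∈ ℤ[X]`, `deg ≤ n`, `Q_{n,h}(0)` = the count on `ℤ¹`**;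
* ★★★ `card_saws_end_axis_eq_sum_classes_mul_descFactorial` — the normal form `Σ_{u ≤ n} G_{n,h}(u)·2^u·d(d−1)⋯(d−u+1)`;
* ★★ `dvd_sub_card_saws_end_axis` — `4dd′(d−d′) ∣ d′(N_{n,h}(d) − N_{n,h}(0)) − d(N_{n,h}(d′) − N_{n,h}(0))`.
So the on-axis two-point numbers of the SAW in `ℤ^{d+1}`, for fixed `n` and height `h`, are integer polynomials in the number `2d` of lateral directions.
[cite: MadrasSlade1993, §1.1 eq. (1.1.8) p. 5; §1.3] [cite: Graham2010, Section 4]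

Provenance: lane «pcv-sawmu», a-p3 g25 (2026-08-28). PURE STD, no data, no definitions (the class is written inline as a filter of `saws`).
-/

noncomputable section

open Finset
open scoped BigOperators
open Literature.Probability.LatticeModels
open Literature.Probability.RandomPlanarGeometry.SAW

namespace Literature.Probability.RandomPlanarGeometry.SAW.Zd

/-! ## §17 The two-point count along the force axis: `c_n(0 → h·e₀)` on `ℤ^{d+1}` is an integer polynomial in `2d` -/

section AxisTwoPoint

/-- The zero-extension along a lateral injection fixing `0` preserves the force coordinate. [folklore] -/
private theorem tp_extend_apply_zero {u d : ℕ} {e : Fin (u + 1) → Fin (d + 1)} (he : Function.Injective e) (he0 : e 0 = 0)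
    (x : Site (u + 1)) : Function.extend e x (0 : Fin (d + 1) → ℤ) 0 = x 0 := by
  rw [← he0, he.extend_apply]

/-- A site has vanishing lateral part iff its zero-extension has. [folklore] -/
private theorem tp_extend_lateral_zero_iff {u d : ℕ} {e : Fin (u + 1) → Fin (d + 1)} (he : Function.Injective e) (he0 : e 0 = 0)
    (x : Site (u + 1)) :
    (∀ b : Fin (d + 1), b ≠ 0 → Function.extend e x (0 : Fin (d + 1) → ℤ) b = 0) ↔ (∀ a : Fin (u + 1), a ≠ 0 → x a = 0) := by
  constructor
  · intro h a ha
    have := h (e a) (fun hea => ha (he (hea.trans he0.symm)))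
    rwa [he.extend_apply] at this
  · intro h b hb
    by_cases hex : ∃ a, e a = b
    · obtain ⟨a, rfl⟩ := hex
      rw [he.extend_apply]
      exact h a (fun ha => hb (by rw [ha, he0]))
    · rw [Function.extend_apply' _ _ _ hex]
      rfl

/-- A site has vanishing lateral part iff its signed lateral relabelling has. [folklore] -/
private theorem tp_latRelabel_lateral_zero_iff {u : ℕ} (g : Equiv.Perm (Fin u) × (Fin u → Bool)) (x : Site (u + 1)) :
    (∀ a : Fin (u + 1), a ≠ 0 → latRelabel u g x a = 0) ↔ (∀ a : Fin (u + 1), a ≠ 0 → x a = 0) := by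
  constructor
  · intro h a ha
    obtain ⟨b, rfl⟩ := Fin.exists_succ_eq.2 ha
    have := h (g.1 b).succ (Fin.succ_ne_zero _)
    rw [latRelabel_apply_succ_perm] at this
    split_ifs at this with hb
    · exact neg_eq_zero.1 this
    · exact this
  · intro h a ha
    obtain ⟨b, rfl⟩ := Fin.exists_succ_eq.2 ha
    rw [latRelabel_apply_succ, h _ (Fin.succ_ne_zero _)]
    split_ifs <;> simp

/-- The class «endpoint at height `h` on the force axis» is transported by the lateral zero-extensions. [folklore] -/
private theorem tp_ext (n : ℕ) (h : ℤ) {u d : ℕ} {e : Fin (u + 1) → Fin (d + 1)} (he : Function.Injective e) (he0 : e 0 = 0)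
    (ω : ℕ → Site (u + 1)) :
    ((fun i => Function.extend e (ω i) (0 : Fin (d + 1) → ℤ)) n 0 = h ∧
        ∀ a : Fin (d + 1), a ≠ 0 → (fun i => Function.extend e (ω i) (0 : Fin (d + 1) → ℤ)) n a = 0) ↔
      (ω n 0 = h ∧ ∀ a : Fin (u + 1), a ≠ 0 → ω n a = 0) := by
  dsimp only
  rw [tp_extend_apply_zero he he0, tp_extend_lateral_zero_iff he he0]

/-- The class «endpoint at height `h` on the force axis» is invariant under the signed relabellings of the lateral axes. [folklore] -/
private theorem tp_rel (n : ℕ) (h : ℤ) (u : ℕ) (g : Equiv.Perm (Fin u) × (Fin u → Bool)) (ω : ℕ → Site (u + 1)) :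
    ((fun i => latRelabel u g (ω i)) n 0 = h ∧ ∀ a : Fin (u + 1), a ≠ 0 → (fun i => latRelabel u g (ω i)) n a = 0) ↔
      (ω n 0 = h ∧ ∀ a : Fin (u + 1), a ≠ 0 → ω n a = 0) := by
  dsimp only
  rw [latRelabel_apply_zero, tp_latRelabel_lateral_zero_iff]

/-- ★★★ **THE TWO-POINT COUNT ALONG THE FORCE AXIS IS AN INTEGER POLYNOMIAL IN `2d`**: for every `n`, `h` there is `Q_{n,h} ∈ ℤ[X]` of degree `≤ n` with
`#{ω ∈ SAW_n(ℤ^{d+1}) : ω(n) = h·e₀} = Q_{n,h}(2d)` for EVERY `d`, and `Q_{n,h}(0)` = the count on the line `ℤ¹` (`= [|h| = n]` for `n ≥ 1`); with the hyperoctahedral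
normal form `Σ_u G_{n,h}(u)·2^u·d(d−1)⋯(d−u+1)` and the dimension congruence `4dd′(d−d′) ∣ d′(N(d) − N(0)) − d(N(d′) − N(0))`. (Generic lateral axis-class census
applied to the class «endpoint on the force axis at height `h`», which is transported by lateral zero-extensions and invariant under the signed relabellings of the
lateral axes.) [cite: MadrasSlade1993, §1.1 eq. (1.1.8) p. 5; §1.3 (the two-point function c_n(0,x))] [cite: Graham2010, Section 4] -/
theorem exists_int_polynomial_card_saws_end_axis (n : ℕ) (h : ℤ) :
    open Classical in
    ∃ Q : Polynomial ℤ, Q.natDegree ≤ n ∧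
      Q.coeff 0 = (((saws 1 n).filter fun (Ω : ℕ → Site 1) => Ω n 0 = h ∧ ∀ a : Fin 1, a ≠ 0 → Ω n a = 0).card : ℤ) ∧
      ∀ d : ℕ, ((((saws (d + 1) n).filter fun (Ω : ℕ → Site (d + 1)) => Ω n 0 = h ∧ ∀ a : Fin (d + 1), a ≠ 0 → Ω n a = 0).card : ℕ) : ℤ) =
        Q.eval (2 * (d : ℤ)) := by
  obtain ⟨Q, h1, h2, h3⟩ := exists_int_polynomial_card_filter_saws (n := n) (fun D Ω => Ω n 0 = h ∧ ∀ a : Fin (D + 1), a ≠ 0 → Ω n a = 0)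
    (fun he he0 ω => tp_ext n h he he0 ω) (fun u g ω _ => tp_rel n h u g ω)
  exact ⟨Q, h1, by convert h2, fun d => by convert h3 d⟩

/-- ★★★ **NORMAL FORM OF THE AXIS TWO-POINT COUNT**: `#{ω ∈ SAW_n(ℤ^{d+1}) : ω(n) = h·e₀} = Σ_{u ≤ n} G_{n,h}(u)·2^u·d(d−1)⋯(d−u+1)` for every `d`, `G_{n,h}(u)` the
number of hyperoctahedral classes of such walks of `ℤ^{u+1}` using every lateral axis. [cite: MadrasSlade1993, §1.1 eq. (1.1.8) p. 5; §1.3] [cite: Graham2010, Section 4] -/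
theorem card_saws_end_axis_eq_sum_classes_mul_descFactorial (d n : ℕ) (h : ℤ) :
    open Classical in
    ((saws (d + 1) n).filter fun (Ω : ℕ → Site (d + 1)) => Ω n 0 = h ∧ ∀ a : Fin (d + 1), a ≠ 0 → Ω n a = 0).card =
      ∑ u ∈ Finset.range (n + 1),
        ((saws (u + 1) n).filter fun (ω : ℕ → Site (u + 1)) => (ω n 0 = h ∧ ∀ a : Fin (u + 1), a ≠ 0 → ω n a = 0) ∧
          ∀ a : Fin (u + 1), a ≠ 0 → ∃ i ≤ n, ω i a ≠ (0 : ℤ)).card / (2 ^ u * u.factorial) * (2 ^ u * d.descFactorial u) := by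
  convert card_filter_saws_eq_sum_classes_mul_descFactorial (n := n) (fun D Ω => Ω n 0 = h ∧ ∀ a : Fin (D + 1), a ≠ 0 → Ω n a = 0)
    (fun he he0 ω => tp_ext n h he he0 ω) (fun u g ω _ => tp_rel n h u g ω) d

/-- ★★ **DIMENSION CONGRUENCE FOR THE AXIS TWO-POINT COUNT**: with `N_{n,h}(d) = #{ω ∈ SAW_n(ℤ^{d+1}) : ω(n) = h·e₀}`,
`4dd′(d − d′) ∣ d′(N_{n,h}(d) − N_{n,h}(0)) − d(N_{n,h}(d′) − N_{n,h}(0))`. [cite: MadrasSlade1993, §1.3] [cite: Graham2010, Section 4] -/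
theorem dvd_sub_card_saws_end_axis (n : ℕ) (h : ℤ) (d d' : ℕ) :
    open Classical in
    (4 * (d : ℤ) * d' * ((d : ℤ) - d')) ∣
      (d' : ℤ) * ((((saws (d + 1) n).filter fun (Ω : ℕ → Site (d + 1)) => Ω n 0 = h ∧ ∀ a : Fin (d + 1), a ≠ 0 → Ω n a = 0).card : ℤ) -
          (((saws 1 n).filter fun (Ω : ℕ → Site 1) => Ω n 0 = h ∧ ∀ a : Fin 1, a ≠ 0 → Ω n a = 0).card : ℤ)) -
      (d : ℤ) * ((((saws (d' + 1) n).filter fun (Ω : ℕ → Site (d' + 1)) => Ω n 0 = h ∧ ∀ a : Fin (d' + 1), a ≠ 0 → Ω n a = 0).card : ℤ) -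
          (((saws 1 n).filter fun (Ω : ℕ → Site 1) => Ω n 0 = h ∧ ∀ a : Fin 1, a ≠ 0 → Ω n a = 0).card : ℤ)) := by
  convert dvd_sub_card_filter_saws (n := n) (fun D Ω => Ω n 0 = h ∧ ∀ a : Fin (D + 1), a ≠ 0 → Ω n a = 0)
    (fun he he0 ω => tp_ext n h he he0 ω) (fun u g ω _ => tp_rel n h u g ω) d d'

end AxisTwoPoint

end Literature.Probability.RandomPlanarGeometry.SAW.Zd

end
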